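import Summits.QuantumFields.YangMills.Theorems.BalabanUVNodesN18U3TowerGuards

/-!
# BalabanUVNodes ∕ node N18 = NE5 — U3 TOWER GUARDS, CONTINUED: (a) the node-U3 K4 slots are BLIND TO THE CARRIER's CLOSENESS GAUGE (kernel `Iff.rfl`), (b) the RUN-B
# twin of the located per-run-length finding — under `RepresentsB` at a run-tower level `k`, β one step up is blind to the couplings the level-`k` family cannot see

Cell `pub-ymgap`, width seat `pub-ymgap-dag-n18-w2` (HUMAN RULING D-0149; plan `W-SEAT-START-LIST` §n18 ITEM 2, continued).  `--supports stmt-QuantumFields-20544` (K3⁷) AS A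
HELPER — count-neutral.  Two `def`s (carrier ∕ bundle with the gauge field REPLACED — bookkeeping devices) + kernel bookkeeping.

* §1 GAUGE INDEPENDENCE (justifies the documented junk value `gauge := 0` of `W1.ReadingData.allRunsCarriers`, p585996): `carriersWithGauge C g hg`, `u3WithGauge u g hg`
  (same domains, scales, tree lengths, backgrounds, transport, window, functionals and letters; only the closeness gauge replaced); `n18At_withGauge_iff`, `n22At_withGauge_iff`,
  `n17At_withGauge_iff`, `readOutAt_withGauge_iff`, `sensitiveOnBoxes_withGauge_iff` — ALL `Iff.rfl`: none of `N17At ∕ N18At ∕ N22At ∕ ReadOutAt`, nor the guard, reads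
  `Carriers.gauge` (it serves the NE3 ∕ `BackgroundsClose` consumers only).
* §2 RUN B AT A RUN-TOWER LEVEL (twin of `U3Guards.EA_eq_of_agree_below` ∕ `beta_eq_of_readOutAt_runLevel`): for W1 reading data whose run-length-`(k+1)` tower creates no
  term after step `k+1` (`W1.TermlessBeyond (Dw.S (k+1)) (k+1)` — every `runTowers S′`), `EB_eq_of_agree_below` — the level-`k` first-coupling family at `(b, g)` and `(b, g')`
  COINCIDES when `g, g'` agree on the indices `< k` (the prepended history `b∷g` is read below the creation step `≤ k+1` of the paired domain); hence under (D4)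
  `betaSucc_eq_of_readOutAt_runLevel`: `D.βfun (k′+1) w = D.βfun (k′+1) w'` for box histories with the same first coupling whose tails agree below `k` as padded sequences —
  at `k = 0`: `β (k′+1)` on `]0,γ]^{k′+2}` depends on the FIRST coupling `w 0` only (`betaSucc_eq_of_readOutAt_level_zero_of_head_eq`).

HONEST FRAMING.  Bookkeeping over typed SHAPES and W1's RESIDUAL reading data; nothing of Bałaban's asserted; NE5 ∕ NE9 ∕ (D4) NOT PRINTED for d = 4 ∕ NOT proved; §2 is a
located VACUITY finding about a binder placement (A6 class), as in `U3Guards` §3; N18 NOT discharged; K3⁷ OPEN, not claimed; counts UNMOVED (typed 28∕28 · discharged 5∕27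
(A 5∕28)).  One finite four-torus programme at fixed `ε`; R4 closes the conditional finite-𝕋⁴ rung `BalabanLadder.UV` only — NOT ℝ⁴, NOT infinite volume, NOT OS, NOT a mass
gap, NOT Clay.  No `sorry`, no `instance`.
-/

set_option autoImplicit false

noncomputable section

namespace YMDAG.N18.U3Guards

open Literature.MathematicalPhysics.QuantumFieldTheory.Balaban1983to89
open Literature.MathematicalPhysics.QuantumFieldTheory.Balaban1983to89.T4Continuum
open Literature.MathematicalPhysics.QuantumFieldTheory.Balaban1983to89.FlowStep (Box)
open Literature.MathematicalPhysics.QuantumFieldTheory.Balaban1983to89.T4FlagMemory (extd extd_coe)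
open Literature.MathematicalPhysics.QuantumFieldTheory.Balaban1983to89.T4OutputRate (Carriers Functional)
open Literature.MathematicalPhysics.QuantumFieldTheory.Balaban1983to89.Node00 (Stage13Params prependCoupling prependCoupling_zero prependCoupling_succ)
open Literature.MathematicalPhysics.QuantumFieldTheory.Balaban1983to89.Node00.W1 (ReadingData TermlessBeyond termC termC_congr_prefix functionalC)
open YMDAG.UVSplit

/-! ## §1 The node-U3 K4 slots are blind to the closeness gauge -/

section Gauge

/-- The carriers with the closeness gauge REPLACED by `g` (domains, creation steps, tree lengths, backgrounds and transport unchanged) — a bookkeeping device. [folklore] -/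
@[folklore]
def carriersWithGauge (C : Carriers) (g : C.BgA → C.BgA → ℝ)
    (hg : ∀ U U', 0 ≤ g U U') : Carriers :=
  { C with gauge := g, gauge_nonneg := hg }

/-- Node U3's bundle with the closeness gauge of its carriers REPLACED (window, radius, functionals and letters unchanged) — a bookkeeping device. [folklore] -/
@[folklore]
def u3WithGauge (u : U3Carriers) (g : u.C.BgA → u.C.BgA → ℝ) (hg : ∀ U U', 0 ≤ g U U') : U3Carriers :=
  ⟨carriersWithGauge u.C g hg, u.W, u.γ, u.κ, u.EA, u.EB, u.θ, u.C₅, u.Λ, u.C₉, u.ω, u.cr, u.ρ⟩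

variable (u : U3Carriers) (g : u.C.BgA → u.C.BgA → ℝ) (hg : ∀ U U', 0 ≤ g U U')

/-- The replaced gauge IS `g` (`rfl`). [folklore] -/
theorem withGauge_gauge (U U' : u.C.BgA) : (u3WithGauge u g hg).C.gauge U U' = g U U' := rfl

/-- **N18 (NE5) DOES NOT READ THE GAUGE** (`Iff.rfl`). [folklore] -/
theorem n18At_withGauge_iff : N18At (u3WithGauge u g hg) ↔ N18At u := Iff.rfl

/-- **N22 (NE9 ∧ fading memory) DOES NOT READ THE GAUGE** (`Iff.rfl`). [folklore] -/
theorem n22At_withGauge_iff : N22At (u3WithGauge u g hg) ↔ N22At u := Iff.rfl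

variable {F : T4Family} {N : ℕ} [NeZero N]

/-- **N17 (NE4 on the datum) DOES NOT READ THE GAUGE** (`Iff.rfl`). [folklore] -/
theorem n17At_withGauge_iff (D : Datum F N) : N17At D (u3WithGauge u g hg) ↔ N17At D u := Iff.rfl

/-- **(D4) DOES NOT READ THE GAUGE** (`Iff.rfl`: `RepresentsA∕B`, the slice classes, `ReadBoundedOn`, `ReadCovariantOn` and the letter signs see scales, tree lengths,
transport and functionals only). [folklore] -/
theorem readOutAt_withGauge_iff (D : Datum F N) : ReadOutAt D (u3WithGauge u g hg) ↔ ReadOutAt D u := Iff.rfl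

/-- **THE GUARD DOES NOT READ THE GAUGE** (`Iff.rfl`). [folklore] -/
theorem sensitiveOnBoxes_withGauge_iff : SensitiveOnBoxes (u3WithGauge u g hg).EA (u3WithGauge u g hg).γ ↔ SensitiveOnBoxes u.EA u.γ := Iff.rfl

end Gauge

/-! ## §2 Run B at a run-tower level: the first-coupling family reads `b` and the couplings below `k` only -/

section RunB

variable {F : T4Family} {𝔸 : Type*} {M : ℕ}

/-- **THE LEVEL-`k` FIRST-COUPLING FAMILY OF A RUN-TOWER READING SEES `b` AND THE COUPLINGS BELOW `k` ONLY**: if the run-length-`(k+1)` tower creates no term after step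
`k+1`, then for the same first coupling `b` and two re-indexed histories agreeing on the indices `< k` the family's slices COINCIDE (a term of creation step `j′ ≤ k+1` at the
paired domain reads `(b∷g)_0, …, (b∷g)_{j′−1} = b, g_0, …, g_{j′−2}`; later steps vanish). [folklore] -/
theorem EB_eq_of_agree_below (Dw : ReadingData F 𝔸 M) (γℓ : ℝ) {k : ℕ} (hT : TermlessBeyond (Dw.S (k + 1)) (k + 1)) (b : ℝ) {g g' : ℕ → ℝ}
    (hag : ∀ i, i < k → g i = g' i) : (Dw.u3Objects γℓ).EB k b g = (Dw.u3Objects γℓ).EB k b g' := by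
  funext U X
  rw [ReadingData.u3Objects_EB_apply, ReadingData.u3Objects_EB_apply]
  show (termC (Dw.S (k + 1)) ((Dw.pairing k).pair X).1 ((Dw.pairing k).pair X).2 (prependCoupling b g) _).re =
    (termC (Dw.S (k + 1)) ((Dw.pairing k).pair X).1 ((Dw.pairing k).pair X).2 (prependCoupling b g') _).re
  by_cases hj : ((Dw.pairing k).pair X).1 ≤ k + 1
  · rw [termC_congr_prefix (Dw.S (k + 1)) _ _ (g := prependCoupling b g) (g' := prependCoupling b g') (fun i hi => ?_)]
    cases i with
    | zero => rfl
    | succ i => exact hag i (by omega)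
  · rw [hT _ _ (prependCoupling b g) _ (lt_of_not_ge hj), hT _ _ (prependCoupling b g') _ (lt_of_not_ge hj)]

variable {N : ℕ} [NeZero N]

/-- **★ (D4) KEYED AT RUN LENGTH `k` OF A RUN-TOWER READING: β ONE STEP UP IS BLIND TO THE COUPLINGS THE LEVEL-`k` FAMILY CANNOT SEE** — under
`ReadOutAt D (u3OfRecord₁₃ θ (Dw.u3Objects γℓ) k)`, for every step `k′` and `w, w' ∈ ]0,θ.γ]^{k′+2}` with the same first coupling whose tails agree (as padded sequences) on the
indices `< k`: `D.βfun (k′+1) w = D.βfun (k′+1) w'` (the `RepresentsB` conjunct). [folklore] -/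
theorem betaSucc_eq_of_readOutAt_runLevel (θ : Stage13Params F N) (D : Datum F N) (Dw : ReadingData F 𝔸 M) (γℓ : ℝ) {k : ℕ}
    (hT : TermlessBeyond (Dw.S (k + 1)) (k + 1)) (hD4 : ReadOutAt D (u3OfRecord₁₃ θ (Dw.u3Objects γℓ) k))
    {k' : ℕ} {w w' : Fin (k' + 2) → ℝ} (hw : w ∈ Box θ.γ (k' + 1)) (hw' : w' ∈ Box θ.γ (k' + 1)) (h0 : w 0 = w' 0)
    (hag : ∀ i, i < k → extd (Fin.tail w) i = extd (Fin.tail w') i) : D.βfun (k' + 1) w = D.βfun (k' + 1) w' := by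
  obtain ⟨_, _, _, rB, -, -, hB, -⟩ := hD4
  rw [hB k' w hw, hB k' w' hw', ← h0]
  show rB k' ((Dw.u3Objects γℓ).EB k (w 0) (extd (Fin.tail w))) = rB k' ((Dw.u3Objects γℓ).EB k (w 0) (extd (Fin.tail w')))
  rw [EB_eq_of_agree_below Dw γℓ hT (w 0) hag]

/-- **AT RUN LENGTH 0: β ONE STEP UP DEPENDS ON THE FIRST COUPLING ONLY** — under (D4) at the level-0 bundle of a run-tower reading, `D.βfun (k′+1) w = D.βfun (k′+1) w'`
whenever `w 0 = w' 0` (the level-0 family reads run 1's tower, whose only terms are of creation step 1 and read the prepended coupling alone). [folklore] -/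
theorem betaSucc_eq_of_readOutAt_level_zero_of_head_eq (θ : Stage13Params F N) (D : Datum F N) (Dw : ReadingData F 𝔸 M) (γℓ : ℝ)
    (hT : TermlessBeyond (Dw.S 1) 1) (hD4 : ReadOutAt D (u3OfRecord₁₃ θ (Dw.u3Objects γℓ) 0))
    {k' : ℕ} {w w' : Fin (k' + 2) → ℝ} (hw : w ∈ Box θ.γ (k' + 1)) (hw' : w' ∈ Box θ.γ (k' + 1)) (h0 : w 0 = w' 0) :
    D.βfun (k' + 1) w = D.βfun (k' + 1) w' :=
  betaSucc_eq_of_readOutAt_runLevel θ D Dw γℓ hT hD4 hw hw' h0 fun i hi => absurd hi (Nat.not_lt_zero i)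

end RunB

end YMDAG.N18.U3Guards

end
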